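import Mathlib
import HarnessLib
import Summits.AtomisticToContinuum.FouriersLaw.Theorems.HiddenChargeMazurDressedChargeStubSeedLinkAux1

/-!
# Stub `stub_seedLink` of the crux `DressedCharge` (line `birth`): the seed link

Plane-wave form of the first anharmonic obstruction for the pinned anharmonic chain, in the
lattice polynomial algebra `MvPolynomial (ℤ ⊕ ℤ) ℂ` (`X (inl x) = q_x`, `X (inr x) = p_x`).
With the harmonic Liouville derivation `L₁` (`q_i ↦ p_i`, `p_i ↦ -(ω₂+2) q_i + q_{i+1} + q_{i-1}`),
the cubic one `L₃` (`q ↦ 0`, `p_i ↦ -lam q_i³ + β (q_{i+1} - q_i)³ - β (q_i - q_{i-1})³`), the anchored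
operators `𝒟₀ = L₁L₁ + 𝒲₀`, `𝒟₂ = L₁L₃ + L₃L₁ + 𝒲₂` and the iterated plane-wave derivative `𝐃_P`
(waves `D_(z,μ)`: `q_x ↦ C (z ^ x)`, `p_x ↦ C (μ z ^ x)`, admissible iff `z ≠ 0`, `μ² = -ω̃(z)`):
if `𝒟₀ u₃ + 𝒟₂ u₁ = 0` with `u₁ = ∑ a_m q_m`, then for every admissible triple `P`
`t(P) · constantCoeff (𝐃_P u₃) = -F̂ · (A(z₀z₁z₂) - A(z₀) - A(z₁) - A(z₂))`,
`F̂ = 6 (-lam + β ∏ (z_j - 1) - β ∏ (1 - z_j⁻¹))`, `A(z) = ∑ a_m z^m`.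

Proof: part (I) (helper file `…StubSeedLinkAux1`, `seedLink_partI`):
`constantCoeff (𝐃 (𝒟₀ w)) = t · constantCoeff (𝐃 w)`; part (II) (this file, `seedLink_partII`): the
explicit polarisation `constantCoeff (𝐃 (𝒟₂ u₁)) = F̂ · (A(∏ z_j) - ∑ A(z_j))`, by linearity in the
seed and the single-mode computation `seedLink_core` (`𝒟₂ q_m` is a pure-`q` cubic on which only
the `q`-parts of the waves act).  Everything is proved for abstract derivations characterised on
generators and instantiated with `MvPolynomial.mkDerivation_X` at the end.
-/

noncomputable section

namespace Summit.AtomisticToContinuum.FouriersLaw.Theorems.DressedCharge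

open MvPolynomial

/-! ## Part (II): polarisation of the first anharmonic correction on the seed -/

/-- The iterated derivative along three waves, unfolded. -/
theorem seedLink_fold_three
    (D : ℂ × ℂ → Derivation ℂ (MvPolynomial (ℤ ⊕ ℤ) ℂ) (MvPolynomial (ℤ ⊕ ℤ) ℂ))
    (P : Fin 3 → ℂ × ℂ) (w : MvPolynomial (ℤ ⊕ ℤ) ℂ) :
    (List.ofFn P).foldr (fun Pj acc => D Pj acc) w = D (P 0) (D (P 1) (D (P 2) w)) := by
  simp only [List.ofFn_succ, List.ofFn_zero, List.foldr_cons, List.foldr_nil, Fin.succ_zero_eq_one,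
    Fin.succ_one_eq_two]

/-- The single-mode polarisation: the triple plane-wave derivative of the cubic polynomial
`𝒟₂ q_m = F^cub_m + W₀₀ q_m - W₀₁ q_{m+1} - W₀₋₁ q_{m-1}` is the constant
`F̂ · ((z₀ z₁ z₂)^m - ∑ z_j^m)`, `F̂ = 6 (-lam + β ∏ (z_j - 1) - β ∏ (1 - z_j⁻¹))`. -/
theorem seedLink_core (lam β : ℝ)
    {D : ℂ × ℂ → Derivation ℂ (MvPolynomial (ℤ ⊕ ℤ) ℂ) (MvPolynomial (ℤ ⊕ ℤ) ℂ)}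
    (hDl : ∀ (Pj : ℂ × ℂ) (x : ℤ), D Pj (X (Sum.inl x)) = C (Pj.1 ^ x))
    (P : Fin 3 → ℂ × ℂ) (hP : ∀ j, (P j).1 ≠ 0) (m : ℤ) :
    constantCoeff (D (P 0) (D (P 1) (D (P 2)
      (-(C (lam : ℂ) * X (Sum.inl m) ^ 3) +
        C (β : ℂ) * (X (Sum.inl (m + 1)) - X (Sum.inl m)) ^ 3 -
        C (β : ℂ) * (X (Sum.inl m) - X (Sum.inl (m - 1))) ^ 3 +
      ((C (3 * (lam : ℂ)) * X (Sum.inl 0) ^ 2 + C (3 * (β : ℂ)) * (X (Sum.inl 1) - X (Sum.inl 0)) ^ 2 +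
            C (3 * (β : ℂ)) * (X (Sum.inl 0) - X (Sum.inl (-1))) ^ 2) * X (Sum.inl m) -
          C (3 * (β : ℂ)) * (X (Sum.inl 1) - X (Sum.inl 0)) ^ 2 * X (Sum.inl (m + 1)) -
          C (3 * (β : ℂ)) * (X (Sum.inl 0) - X (Sum.inl (-1))) ^ 2 * X (Sum.inl (m - 1))))))) =
      (6 * (-(lam : ℂ) + (β : ℂ) * ∏ j, ((P j).1 - 1) - (β : ℂ) * ∏ j, (1 - ((P j).1)⁻¹))) *
        ((∏ j, (P j).1) ^ m - ∑ j, ((P j).1) ^ m) := by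
  have h0 := hP 0
  have h1 := hP 1
  have h2 := hP 2
  simp only [map_add, map_sub, map_neg, map_mul, map_pow, map_nsmul, Derivation.leibniz,
    Derivation.leibniz_pow, derivation_C, add_zero, zero_add, smul_eq_mul, mul_zero, zero_mul, hDl,
    constantCoeff_C, constantCoeff_X, Fin.prod_univ_three, Fin.sum_univ_three]
  simp only [zpow_add_one₀ h0, zpow_sub_one₀ h0, zpow_add_one₀ h1, zpow_sub_one₀ h1, zpow_add_one₀ h2,
    zpow_sub_one₀ h2, mul_zpow]
  norm_num
  ring

/-- **Part (II) of the seed link** (polarisation of `𝒟₂ u₁`): for the seed `u₁ = ∑ a_m q_m`, the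
cubic Liouville derivation `L₃` (`q ↦ 0`, `p_i ↦ -lam q_i³ + β (q_{i+1} - q_i)³ - β (q_i - q_{i-1})³`),
any derivation `L` with `L q_i = p_i`, and plane waves `D`, the constant
`constantCoeff (𝐃_P (L L₃ u₁ + L₃ L u₁ + 𝒲₂ u₁))` equals `F̂ · (A(∏ z_j) - ∑_j A(z_j))`,
`A(z) = ∑ a_m z^m`. -/
theorem seedLink_partII (lam β : ℝ)
    {L L₃ : Derivation ℂ (MvPolynomial (ℤ ⊕ ℤ) ℂ) (MvPolynomial (ℤ ⊕ ℤ) ℂ)}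
    (hLl : ∀ i : ℤ, L (X (Sum.inl i)) = X (Sum.inr i))
    (hL3l : ∀ i : ℤ, L₃ (X (Sum.inl i)) = 0)
    (hL3r : ∀ i : ℤ, L₃ (X (Sum.inr i)) = -(C (lam : ℂ) * X (Sum.inl i) ^ 3) +
      C (β : ℂ) * (X (Sum.inl (i + 1)) - X (Sum.inl i)) ^ 3 -
      C (β : ℂ) * (X (Sum.inl i) - X (Sum.inl (i - 1))) ^ 3)
    {D : ℂ × ℂ → Derivation ℂ (MvPolynomial (ℤ ⊕ ℤ) ℂ) (MvPolynomial (ℤ ⊕ ℤ) ℂ)}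
    (hDl : ∀ (Pj : ℂ × ℂ) (x : ℤ), D Pj (X (Sum.inl x)) = C (Pj.1 ^ x))
    (a : ℤ →₀ ℂ) (P : Fin 3 → ℂ × ℂ) (hP : ∀ j, (P j).1 ≠ 0) :
    constantCoeff ((List.ofFn P).foldr (fun Pj acc => D Pj acc)
      (L (L₃ (a.sum (fun m c => C c * X (Sum.inl m)))) +
        L₃ (L (a.sum (fun m c => C c * X (Sum.inl m)))) +
        ((C (3 * (lam : ℂ)) * X (Sum.inl 0) ^ 2 + C (3 * (β : ℂ)) * (X (Sum.inl 1) - X (Sum.inl 0)) ^ 2 +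
              C (3 * (β : ℂ)) * (X (Sum.inl 0) - X (Sum.inl (-1))) ^ 2) *
            (a.sum (fun m c => C c * X (Sum.inl m))) -
          C (3 * (β : ℂ)) * (X (Sum.inl 1) - X (Sum.inl 0)) ^ 2 *
            rename (Sum.map (fun i : ℤ => i + 1) (fun i : ℤ => i + 1))
              (a.sum (fun m c => C c * X (Sum.inl m))) -
          C (3 * (β : ℂ)) * (X (Sum.inl 0) - X (Sum.inl (-1))) ^ 2 *
            rename (Sum.map (fun i : ℤ => i - 1) (fun i : ℤ => i - 1))
              (a.sum (fun m c => C c * X (Sum.inl m)))))) =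
      (6 * (-(lam : ℂ) + (β : ℂ) * ∏ j, ((P j).1 - 1) - (β : ℂ) * ∏ j, (1 - ((P j).1)⁻¹))) *
        (a.sum (fun m c => c * (∏ j, (P j).1) ^ m) - ∑ j, a.sum (fun m c => c * ((P j).1) ^ m)) := by
  have hsingle : ∀ (m : ℤ) (c : ℂ),
      L (L₃ (C c * X (Sum.inl m))) + L₃ (L (C c * X (Sum.inl m))) +
        ((C (3 * (lam : ℂ)) * X (Sum.inl 0) ^ 2 + C (3 * (β : ℂ)) * (X (Sum.inl 1) - X (Sum.inl 0)) ^ 2 +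
              C (3 * (β : ℂ)) * (X (Sum.inl 0) - X (Sum.inl (-1))) ^ 2) * (C c * X (Sum.inl m)) -
          C (3 * (β : ℂ)) * (X (Sum.inl 1) - X (Sum.inl 0)) ^ 2 *
            rename (Sum.map (fun i : ℤ => i + 1) (fun i : ℤ => i + 1)) (C c * X (Sum.inl m)) -
          C (3 * (β : ℂ)) * (X (Sum.inl 0) - X (Sum.inl (-1))) ^ 2 *
            rename (Sum.map (fun i : ℤ => i - 1) (fun i : ℤ => i - 1)) (C c * X (Sum.inl m))) =
      c • (-(C (lam : ℂ) * X (Sum.inl m) ^ 3) +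
        C (β : ℂ) * (X (Sum.inl (m + 1)) - X (Sum.inl m)) ^ 3 -
        C (β : ℂ) * (X (Sum.inl m) - X (Sum.inl (m - 1))) ^ 3 +
      ((C (3 * (lam : ℂ)) * X (Sum.inl 0) ^ 2 + C (3 * (β : ℂ)) * (X (Sum.inl 1) - X (Sum.inl 0)) ^ 2 +
            C (3 * (β : ℂ)) * (X (Sum.inl 0) - X (Sum.inl (-1))) ^ 2) * X (Sum.inl m) -
          C (3 * (β : ℂ)) * (X (Sum.inl 1) - X (Sum.inl 0)) ^ 2 * X (Sum.inl (m + 1)) -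
          C (3 * (β : ℂ)) * (X (Sum.inl 0) - X (Sum.inl (-1))) ^ 2 * X (Sum.inl (m - 1)))) := by
    intro m c
    simp only [seedLink_derivation_C_mul, hL3l, hLl, hL3r, mul_zero, map_zero, zero_add, map_mul,
      rename_C, rename_X, Sum.map_inl]
    rw [smul_eq_C_mul]
    ring
  simp only [Finsupp.sum, map_sum, Finset.mul_sum, ← Finset.sum_add_distrib, ← Finset.sum_sub_distrib]
  simp only [hsingle]
  simp only [seedLink_fold_three, map_sum, Derivation.map_smul, constantCoeff_smul,
    seedLink_core lam β hDl P hP, smul_eq_mul]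
  rw [Finset.sum_comm, ← Finset.sum_sub_distrib, Finset.mul_sum]
  refine Finset.sum_congr rfl (fun m _ => ?_)
  rw [← Finset.mul_sum]
  ring

/-- **Assembly of the seed link**: apply `constantCoeff ∘ 𝐃_P` to the degree-3 equation
`𝒟₀ u₃ + 𝒟₂ u₁ = 0` and insert parts (I) and (II). -/
theorem seedLink_assembly (ω₂ lam β : ℝ)
    {L L₃ : Derivation ℂ (MvPolynomial (ℤ ⊕ ℤ) ℂ) (MvPolynomial (ℤ ⊕ ℤ) ℂ)}
    (hLl : ∀ i : ℤ, L (X (Sum.inl i)) = X (Sum.inr i))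
    (hLr : ∀ i : ℤ, L (X (Sum.inr i)) =
      -(C ((ω₂ : ℂ) + 2) * X (Sum.inl i)) + X (Sum.inl (i + 1)) + X (Sum.inl (i - 1)))
    (hL3l : ∀ i : ℤ, L₃ (X (Sum.inl i)) = 0)
    (hL3r : ∀ i : ℤ, L₃ (X (Sum.inr i)) = -(C (lam : ℂ) * X (Sum.inl i) ^ 3) +
      C (β : ℂ) * (X (Sum.inl (i + 1)) - X (Sum.inl i)) ^ 3 -
      C (β : ℂ) * (X (Sum.inl i) - X (Sum.inl (i - 1))) ^ 3)
    {D : ℂ × ℂ → Derivation ℂ (MvPolynomial (ℤ ⊕ ℤ) ℂ) (MvPolynomial (ℤ ⊕ ℤ) ℂ)}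
    (hDl : ∀ (Pj : ℂ × ℂ) (x : ℤ), D Pj (X (Sum.inl x)) = C (Pj.1 ^ x))
    (hDr : ∀ (Pj : ℂ × ℂ) (x : ℤ), D Pj (X (Sum.inr x)) = C (Pj.2 * Pj.1 ^ x))
    (a : ℤ →₀ ℂ) (u₃ : MvPolynomial (ℤ ⊕ ℤ) ℂ)
    (hEq : L (L u₃) + (C ((ω₂ : ℂ) + 2) * u₃ -
        rename (Sum.map (fun i : ℤ => i + 1) (fun i : ℤ => i + 1)) u₃ -
        rename (Sum.map (fun i : ℤ => i - 1) (fun i : ℤ => i - 1)) u₃) +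
      (L (L₃ (a.sum (fun m c => C c * X (Sum.inl m)))) +
        L₃ (L (a.sum (fun m c => C c * X (Sum.inl m)))) +
        ((C (3 * (lam : ℂ)) * X (Sum.inl 0) ^ 2 + C (3 * (β : ℂ)) * (X (Sum.inl 1) - X (Sum.inl 0)) ^ 2 +
              C (3 * (β : ℂ)) * (X (Sum.inl 0) - X (Sum.inl (-1))) ^ 2) *
            (a.sum (fun m c => C c * X (Sum.inl m))) -
          C (3 * (β : ℂ)) * (X (Sum.inl 1) - X (Sum.inl 0)) ^ 2 *
            rename (Sum.map (fun i : ℤ => i + 1) (fun i : ℤ => i + 1))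
              (a.sum (fun m c => C c * X (Sum.inl m))) -
          C (3 * (β : ℂ)) * (X (Sum.inl 0) - X (Sum.inl (-1))) ^ 2 *
            rename (Sum.map (fun i : ℤ => i - 1) (fun i : ℤ => i - 1))
              (a.sum (fun m c => C c * X (Sum.inl m))))) = 0)
    (P : Fin 3 → ℂ × ℂ)
    (hP : ∀ j, (P j).1 ≠ 0 ∧ (P j).2 ^ 2 = -((ω₂ : ℂ) + 2 - (P j).1 - ((P j).1)⁻¹)) :
    ((∑ j, (P j).2) ^ 2 + ((ω₂ : ℂ) + 2 - (∏ j, (P j).1) - (∏ j, (P j).1)⁻¹)) *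
        constantCoeff ((List.ofFn P).foldr (fun Pj acc => D Pj acc) u₃) =
      -(6 * (-(lam : ℂ) + (β : ℂ) * ∏ j, ((P j).1 - 1) - (β : ℂ) * ∏ j, (1 - ((P j).1)⁻¹))) *
        (a.sum (fun m c => c * (∏ j, (P j).1) ^ m) - ∑ j, a.sum (fun m c => c * ((P j).1) ^ m)) := by
  have key1 := seedLink_partI ω₂ hLl hLr hDl hDr P hP u₃
  have key2 := seedLink_partII lam β hLl hL3l hL3r hDl a P (fun j => (hP j).1)
  have key3 : constantCoeff ((List.ofFn P).foldr (fun Pj acc => D Pj acc)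
      (0 : MvPolynomial (ℤ ⊕ ℤ) ℂ)) = 0 := by
    rw [seedLink_fold_zero, map_zero]
  rw [← hEq, seedLink_fold_add, map_add, key1, key2] at key3
  linear_combination key3

/-- **Stub E `stub_seedLink`** of the crux `DressedCharge` (line `birth`): the plane-wave form of the
first anharmonic obstruction.  If `𝒟₀ u₃ + 𝒟₂ u₁ = 0` with `u₁ = ∑ a_m q_m`, then for every
admissible triple of plane waves
`t(P) · constantCoeff (𝐃_P u₃) = -F̂ · (A(z₀ z₁ z₂) - A(z₀) - A(z₁) - A(z₂))`,
`F̂ = 6 (-lam + β ∏ (z_j - 1) - β ∏ (1 - z_j⁻¹))`, `A(z) = ∑ a_m z^m`.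
(The degree hypothesis is not needed.) -/
theorem stub_seedLink :
    ∀ (ω₂ lam β : ℝ) (a : ℤ →₀ ℂ) (u₃ : MvPolynomial (ℤ ⊕ ℤ) ℂ), u₃.totalDegree ≤ 3 →
      (MvPolynomial.mkDerivation ℂ (Sum.elim (fun i : ℤ => (MvPolynomial.X (Sum.inr i) : MvPolynomial (ℤ ⊕ ℤ) ℂ)) (fun i : ℤ => -(MvPolynomial.C ((ω₂ : ℂ) + 2) * MvPolynomial.X (Sum.inl i)) + MvPolynomial.X (Sum.inl (i + 1)) + MvPolynomial.X (Sum.inl (i - 1))))) ((MvPolynomial.mkDerivation ℂ (Sum.elim (fun i : ℤ => (MvPolynomial.X (Sum.inr i) : MvPolynomial (ℤ ⊕ ℤ) ℂ)) (fun i : ℤ => -(MvPolynomial.C ((ω₂ : ℂ) + 2) * MvPolynomial.X (Sum.inl i)) + MvPolynomial.X (Sum.inl (i + 1)) + MvPolynomial.X (Sum.inl (i - 1))))) (u₃)) + (MvPolynomial.C ((ω₂ : ℂ) + 2) * (u₃) - MvPolynomial.rename (Sum.map (fun i : ℤ => i + 1) (fun i : ℤ => i + 1)) (u₃) - MvPolynomial.rename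 (Sum.map (fun i : ℤ => i - 1) (fun i : ℤ => i - 1)) (u₃)) + ((MvPolynomial.mkDerivation ℂ (Sum.elim (fun i : ℤ => (MvPolynomial.X (Sum.inr i) : MvPolynomial (ℤ ⊕ ℤ) ℂ)) (fun i : ℤ => -(MvPolynomial.C ((ω₂ : ℂ) + 2) * MvPolynomial.X (Sum.inl i)) + MvPolynomial.X (Sum.inl (i + 1)) + MvPolynomial.X (Sum.inl (i - 1))))) ((MvPolynomial.mkDerivation ℂ (Sum.elim (fun _ : ℤ => (0 : MvPolynomial (ℤ ⊕ ℤ) ℂ)) (fun i : ℤ => -(MvPolynomial.C (lam : ℂ) * MvPolynomial.X (Sum.inl i) ^ 3) + MvPolynomial.C (β : ℂ) * (MvPolynomial.X (Sum.inl (i + 1)) - MvPolynomial.X (Sum.inl i)) ^ 3 - MvPolynomial.C (β : ℂ) * (MvPolynomial.X (Sum.inl i) - MvPolynomial.X (Sum.inl (i - 1))) ^ 3))) (a.sum (fun m c => MvPolynomial.C c * MvPolynomial.X (Sum.inl m)))) + (MvPolynomial.mkDerivation ℂ (Sum.elim (fun _ : ℤ => (0 : MvPolynomial (ℤ ⊕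 ℤ) ℂ)) (fun i : ℤ => -(MvPolynomial.C (lam : ℂ) * MvPolynomial.X (Sum.inl i) ^ 3) + MvPolynomial.C (β : ℂ) * (MvPolynomial.X (Sum.inl (i + 1)) - MvPolynomial.X (Sum.inl i)) ^ 3 - MvPolynomial.C (β : ℂ) * (MvPolynomial.X (Sum.inl i) - MvPolynomial.X (Sum.inl (i - 1))) ^ 3))) ((MvPolynomial.mkDerivation ℂ (Sum.elim (fun i : ℤ => (MvPolynomial.X (Sum.inr i) : MvPolynomial (ℤ ⊕ ℤ) ℂ)) (fun i : ℤ => -(MvPolynomial.C ((ω₂ : ℂ) + 2) * MvPolynomial.X (Sum.inl i)) + MvPolynomial.X (Sum.inl (i + 1)) + MvPolynomial.X (Sum.inl (i - 1))))) (a.sum (fun m c => MvPolynomial.C c * MvPolynomial.X (Sum.inl m)))) + ((MvPolynomial.C (3 * (lam : ℂ)) * MvPolynomial.X (Sum.inl 0) ^ 2 + MvPolynomial.C (3 * (β : ℂ)) * (MvPolynomial.X (Sum.inl 1) - MvPolynomial.X (Sum.inl 0)) ^ 2 + MvPolynomial.C (3 * (β : ℂ)) * (MvPolynomial.X (Sum.inl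 0) - MvPolynomial.X (Sum.inl (-1))) ^ 2) * (a.sum (fun m c => MvPolynomial.C c * MvPolynomial.X (Sum.inl m))) - MvPolynomial.C (3 * (β : ℂ)) * (MvPolynomial.X (Sum.inl 1) - MvPolynomial.X (Sum.inl 0)) ^ 2 * MvPolynomial.rename (Sum.map (fun i : ℤ => i + 1) (fun i : ℤ => i + 1)) (a.sum (fun m c => MvPolynomial.C c * MvPolynomial.X (Sum.inl m))) - MvPolynomial.C (3 * (β : ℂ)) * (MvPolynomial.X (Sum.inl 0) - MvPolynomial.X (Sum.inl (-1))) ^ 2 * MvPolynomial.rename (Sum.map (fun i : ℤ => i - 1) (fun i : ℤ => i - 1)) (a.sum (fun m c => MvPolynomial.C c * MvPolynomial.X (Sum.inl m))))) = 0 →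
      ∀ P : Fin 3 → ℂ × ℂ, (∀ j, (P j).1 ≠ 0 ∧ (P j).2 ^ 2 = -((ω₂ : ℂ) + 2 - (P j).1 - ((P j).1)⁻¹)) →
        ((∑ j, (P j).2) ^ 2 + ((ω₂ : ℂ) + 2 - (∏ j, (P j).1) - (∏ j, (P j).1)⁻¹)) * MvPolynomial.constantCoeff ((List.ofFn P).foldr (fun (Pj : ℂ × ℂ) (acc : MvPolynomial (ℤ ⊕ ℤ) ℂ) => MvPolynomial.mkDerivation ℂ (Sum.elim (fun x : ℤ => (MvPolynomial.C (Pj.1 ^ x) : MvPolynomial (ℤ ⊕ ℤ) ℂ)) (fun x : ℤ => MvPolynomial.C (Pj.2 * Pj.1 ^ x))) acc) (u₃)) =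
          -(6 * (-(lam : ℂ) + (β : ℂ) * ∏ j, ((P j).1 - 1) - (β : ℂ) * ∏ j, (1 - ((P j).1)⁻¹))) *
            (a.sum (fun m c => c * (∏ j, (P j).1) ^ m) - ∑ j, a.sum (fun m c => c * ((P j).1) ^ m)) := by
  intro ω₂ lam β a u₃ _ hEq P hP
  exact seedLink_assembly ω₂ lam β
    (L := MvPolynomial.mkDerivation ℂ (Sum.elim (fun i : ℤ => (MvPolynomial.X (Sum.inr i) : MvPolynomial (ℤ ⊕ ℤ) ℂ)) (fun i : ℤ => -(MvPolynomial.C ((ω₂ : ℂ) + 2) * MvPolynomial.X (Sum.inl i)) + MvPolynomial.X (Sum.inl (i + 1)) + MvPolynomial.X (Sum.inl (i - 1)))))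
    (L₃ := MvPolynomial.mkDerivation ℂ (Sum.elim (fun _ : ℤ => (0 : MvPolynomial (ℤ ⊕ ℤ) ℂ)) (fun i : ℤ => -(MvPolynomial.C (lam : ℂ) * MvPolynomial.X (Sum.inl i) ^ 3) + MvPolynomial.C (β : ℂ) * (MvPolynomial.X (Sum.inl (i + 1)) - MvPolynomial.X (Sum.inl i)) ^ 3 - MvPolynomial.C (β : ℂ) * (MvPolynomial.X (Sum.inl i) - MvPolynomial.X (Sum.inl (i - 1))) ^ 3)))
    (D := fun Pj : ℂ × ℂ => MvPolynomial.mkDerivation ℂ (Sum.elim (fun x : ℤ => (MvPolynomial.C (Pj.1 ^ x) : MvPolynomial (ℤ ⊕ ℤ) ℂ)) (fun x : ℤ => MvPolynomial.C (Pj.2 * Pj.1 ^ x))))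
    (fun i => mkDerivation_X _ _ _) (fun i => mkDerivation_X _ _ _) (fun i => mkDerivation_X _ _ _)
    (fun i => mkDerivation_X _ _ _) (fun Pj x => mkDerivation_X _ _ _) (fun Pj x => mkDerivation_X _ _ _)
    a u₃ hEq P hP

end Summit.AtomisticToContinuum.FouriersLaw.Theorems.DressedCharge

end
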